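import Summits.MatrixMultiplication.MatrixMultiplication.Theorems.ObstructionCalculusPadInheritance

/-!
# ObstructionDescent — the obstruction calculus, PART 5 of 5: `ObstructionCalculusLocality`

LANDING SPLIT (decomp-mm-lander-1 g1, 2026-08-30; mechanical, for the 400-line lint; REQUESTS #16-ii, decomp-mm SUMMON
Tier 3 (10)) of «Part 1 + Part 1b — the obstruction calculus on cubic tensor formats» of the lens-3 gen-8 kernel
`DegreeFiltration_g8_tree.lean` (sha256 `132d565c…aec8`, 2383 lines; critic-CLEARED decomp-mm STATUS l.348/365; rc0, the
calculus parts sorry-free).  This file = §D «Locality» of weight vectors and the two saturation engines (source lines 966–1315),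
copied byte-identically inside the source namespace `Summit.MatrixMultiplication.MatrixMultiplication.Theorems.ObstructionCalculus`
with the source header (`noncomputable section`, opens).  Route-free: imports Literature / the previous part only, NO `Theses`
file (lint `theses-cone`).  The five parts Action → Invariants → Slots → PadInheritance → Locality form one import chain and
SUPPORT the crux `NoOccurrenceObstruction` (item `stmt-MatrixMultiplication-29040`, route-MatrixMultiplication-ObstructionDescent)
WITHOUT closing anything; nothing here proves ω = 2.  Full mathematical commentary: the module docstring of the source kernel
(HOME/decomp-mm-lens-3/pkg-ObstructionDescent-g8/) and the docstrings below.
-/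

set_option linter.dupNamespace false
set_option autoImplicit false

noncomputable section

open scoped BigOperators
open Filter Asymptotics Finset

namespace Summit.MatrixMultiplication.MatrixMultiplication.Theorems.ObstructionCalculus

open Literature.Computability.AlgebraicComplexity (triad triad_apply tensorRank matMulTensor unitTensor
  exists_eq_sum_triad_of_tensorRank_le actTensor actTensor_apply actTensor_actTensor
  tensorRank_le_card_of_eq_sum)

section Locality

variable {m : ℕ}

/-- Coordinate projection in slot `s` onto the coordinates in `T`. [bookkeeping] -/
def proj (s : Fin 3) (T : Finset (Fin m)) (t : Tensor ℂ m) : Tensor ℂ m :=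
  fun a b c => if slot s (a, b, c) ∈ T then t a b c else 0

/-- **Locality of weight vectors.** A weight vector of type `Λ` does not see, in slot `s`, the coordinates
`a` with `λ⁽ˢ⁾_a = 0`: `f(t) = f(proj_{s,T} t)` whenever `T ⊇ supp λ⁽ˢ⁾`.  (The one-parameter torus
`diag(1 on T, x off T)` in slot `s` fixes `f`, so `x ↦ f(diag·t)` is a polynomial in `x` constant on `x ≠ 0`,
hence constant, and its value at `x = 0` is `f(proj t)`.) [folklore] -/
theorem evalT_eq_evalT_proj {Λ : Fin 3 → Fin m → ℕ} {d : ℕ} {f : MvPolynomial (Idx m) ℂ}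
    (hf : f ∈ hwvSpace Λ d) (s : Fin 3) {T : Finset (Fin m)} (hT : ∀ a, a ∉ T → Λ s a = 0)
    (t : Tensor ℂ m) : evalT t f = evalT (proj s T t) f := by
  classical
  obtain ⟨δ, hδ⟩ : ∃ δ : ℂ → Fin m → ℂ, δ = fun x a => if a ∈ T then 1 else x := ⟨_, rfl⟩
  -- the torus in slot `s` fixes `f`
  have hscale : ∀ x : ℂ, x ≠ 0 →
      evalT (fun a b c => δ x (slot s (a, b, c)) * t a b c) f = evalT t f := by
    intro x hx
    have hB : Matrix.diagonal (δ x) ∈ borel m := diagonal_mem_borel fun a => by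
      rw [hδ]
      dsimp only
      split_ifs
      · exact one_ne_zero
      · exact hx
    have h := evalT_slotAct hf hB t s
    rw [slotAct_diagonal, weightChar_diagonal] at h
    rw [h, Finset.prod_eq_one, one_mul]
    intro a _
    by_cases ha : a ∈ T
    · rw [hδ]
      dsimp only
      rw [if_pos ha, one_pow]
    · rw [hδ, hT a ha, pow_zero]
  -- the polynomial `x ↦ f(δ_x · t)`
  obtain ⟨φ, hφ⟩ : ∃ φ : Idx m → Polynomial ℂ, φ = fun p =>
      if slot s p ∈ T then Polynomial.C (t p.1 p.2.1 p.2.2)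
      else Polynomial.X * Polynomial.C (t p.1 p.2.1 p.2.2) := ⟨_, rfl⟩
  obtain ⟨Q, hQ⟩ : ∃ Q : Polynomial ℂ, Q = MvPolynomial.aeval φ f := ⟨_, rfl⟩
  have hQeval : ∀ x : ℂ, Q.eval x = evalT (fun a b c => δ x (slot s (a, b, c)) * t a b c) f := by
    intro x
    have hx : Q.eval x = Polynomial.aeval x Q := by rw [Polynomial.coe_aeval_eq_eval]
    rw [hx, hQ, MvPolynomial.comp_aeval_apply]
    have hfun : (fun i => Polynomial.aeval x (φ i)) =
        fun p : Idx m => (fun a b c => δ x (slot s (a, b, c)) * t a b c) p.1 p.2.1 p.2.2 := by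
      funext p
      obtain ⟨a, b, c⟩ := p
      rw [hφ, hδ]
      dsimp only
      split_ifs with hp
      · rw [Polynomial.aeval_C, one_mul]
        rfl
      · rw [map_mul, Polynomial.aeval_X, Polynomial.aeval_C]
        rfl
    rw [hfun]
    rfl
  have hQc : Q = Polynomial.C (evalT t f) := by
    apply Polynomial.eq_of_infinite_eval_eq
    have hset : ({0}ᶜ : Set ℂ) ⊆ {x : ℂ | Polynomial.eval x Q = Polynomial.eval x (Polynomial.C (evalT t f))} := by
      intro x hx
      have hx0 : x ≠ 0 := fun h0 => hx (h0 ▸ Set.mem_singleton x)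
      rw [Set.mem_setOf_eq, Polynomial.eval_C, hQeval, hscale x hx0]
    exact ((Set.finite_singleton (0 : ℂ)).infinite_compl).mono hset
  have h0 := hQeval 0
  rw [hQc, Polynomial.eval_C] at h0
  have hXY : (fun a b c => δ 0 (slot s (a, b, c)) * t a b c) = proj s T t := by
    funext a b c
    rw [hδ]
    unfold proj
    dsimp only
    split_ifs
    · rw [one_mul]
    · rw [zero_mul]
  rw [h0, hXY]

/-- A polynomial vanishing on `GL_m³·⟨m⟩` vanishes at every tensor of rank `≤ m`. [cite: BurgisserIkenmeyer2011, §3.1] -/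
theorem evalT_eq_zero_of_tensorRank_le {f : MvPolynomial (Idx m) ℂ}
    (hf : f ∈ orbitVanishing (unitTensor ℂ m)) {u : Tensor ℂ m} (hu : tensorRank u ≤ m) :
    evalT u f = 0 := by
  obtain ⟨w, x, y, hdec⟩ := exists_eq_sum_triad_of_tensorRank_le hu
  have hu' : u = fromCols (fun a l => w l a) (fun b l => x l b) (fun c l => y l c) := by
    rw [hdec]
    rfl
  rw [hu']
  refine evalT_fromCols_eq_zero_of_generic f (fun A B C hA hB hC => ?_) _ _ _
  have h' := hf A B C hA hB hC
  rwa [actTensor_unitTensor] at h'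

/-- `eval x f = f(t_x)` for the tensor `t_x` with entries `x`. [bookkeeping] -/
theorem eval_eq_evalT (x : Idx m → ℂ) (f : MvPolynomial (Idx m) ℂ) :
    MvPolynomial.eval x f = evalT (fun a b c => x (a, b, c)) f := by
  unfold evalT
  rw [← MvPolynomial.aeval_eq_eval]

/-- A decomposition into triads indexed by a finset bounds the rank by its cardinality. [bookkeeping] -/
theorem tensorRank_le_card_of_eq_finset_sum {t : Tensor ℂ m} {σ : Type*} (P : Finset σ)
    (w u v : σ → Fin m → ℂ) (h : t = ∑ q ∈ P, triad (w q) (u q) (v q)) : tensorRank t ≤ P.card := by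
  rw [← Fintype.card_coe P]
  refine tensorRank_le_card_of_eq_sum (σ := ↥P) (fun q => w q) (fun q => u q) (fun q => v q) ?_
  rw [h, ← Finset.sum_coe_sort]

/-- Rank bound from support in slots `0,1`: a tensor supported in `T × T' × [m]` has rank `≤ |T|·|T'|`.
[bookkeeping] -/
theorem tensorRank_le_card_mul_card_of_support₀₁ (T T' : Finset (Fin m)) (t : Tensor ℂ m)
    (h : ∀ a b c, t a b c ≠ 0 → a ∈ T ∧ b ∈ T') : tensorRank t ≤ T.card * T'.card := by
  classical
  rw [← Finset.card_product]
  refine tensorRank_le_card_of_eq_finset_sum (T ×ˢ T') (fun q => Pi.single q.1 (1 : ℂ))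
    (fun q => Pi.single q.2 (1 : ℂ)) (fun q c => t q.1 q.2 c) ?_
  funext a b c
  rw [Finset.sum_apply, Finset.sum_apply, Finset.sum_apply]
  have hterm : ∀ q ∈ T ×ˢ T', triad (Pi.single q.1 (1 : ℂ)) (Pi.single q.2 (1 : ℂ))
      (fun c => t q.1 q.2 c) a b c = if (a, b) = q then t a b c else 0 := by
    rintro ⟨i, j⟩ _
    rw [triad_apply, Pi.single_apply, Pi.single_apply]
    by_cases hi : a = i
    · subst hi
      by_cases hj : b = j
      · subst hj
        simp
      · simp [hj]
    · simp [hi]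
  rw [Finset.sum_congr rfl hterm, Finset.sum_ite_eq]
  by_cases hab : (a, b) ∈ T ×ˢ T'
  · rw [if_pos hab]
  · rw [if_neg hab]
    by_contra hne
    exact hab (Finset.mem_product.2 (h a b c hne))

/-- Rank bound from support in slots `0,2`. [bookkeeping] -/
theorem tensorRank_le_card_mul_card_of_support₀₂ (T T' : Finset (Fin m)) (t : Tensor ℂ m)
    (h : ∀ a b c, t a b c ≠ 0 → a ∈ T ∧ c ∈ T') : tensorRank t ≤ T.card * T'.card := by
  classical
  rw [← Finset.card_product]
  refine tensorRank_le_card_of_eq_finset_sum (T ×ˢ T') (fun q => Pi.single q.1 (1 : ℂ))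
    (fun q b => t q.1 b q.2) (fun q => Pi.single q.2 (1 : ℂ)) ?_
  funext a b c
  rw [Finset.sum_apply, Finset.sum_apply, Finset.sum_apply]
  have hterm : ∀ q ∈ T ×ˢ T', triad (Pi.single q.1 (1 : ℂ)) (fun b => t q.1 b q.2)
      (Pi.single q.2 (1 : ℂ)) a b c = if (a, c) = q then t a b c else 0 := by
    rintro ⟨i, k⟩ _
    rw [triad_apply, Pi.single_apply, Pi.single_apply]
    by_cases hi : a = i
    · subst hi
      by_cases hk : c = k
      · subst hk
        simp
      · simp [hk]
    · simp [hi]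
  rw [Finset.sum_congr rfl hterm, Finset.sum_ite_eq]
  by_cases hac : (a, c) ∈ T ×ˢ T'
  · rw [if_pos hac]
  · rw [if_neg hac]
    by_contra hne
    exact hac (Finset.mem_product.2 (h a b c hne))

/-- Rank bound from support in slots `1,2`. [bookkeeping] -/
theorem tensorRank_le_card_mul_card_of_support₁₂ (T T' : Finset (Fin m)) (t : Tensor ℂ m)
    (h : ∀ a b c, t a b c ≠ 0 → b ∈ T ∧ c ∈ T') : tensorRank t ≤ T.card * T'.card := by
  classical
  rw [← Finset.card_product]
  refine tensorRank_le_card_of_eq_finset_sum (T ×ˢ T') (fun q a => t a q.1 q.2)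
    (fun q => Pi.single q.1 (1 : ℂ)) (fun q => Pi.single q.2 (1 : ℂ)) ?_
  funext a b c
  rw [Finset.sum_apply, Finset.sum_apply, Finset.sum_apply]
  have hterm : ∀ q ∈ T ×ˢ T', triad (fun a => t a q.1 q.2) (Pi.single q.1 (1 : ℂ))
      (Pi.single q.2 (1 : ℂ)) a b c = if (b, c) = q then t a b c else 0 := by
    rintro ⟨j, k⟩ _
    rw [triad_apply, Pi.single_apply, Pi.single_apply]
    by_cases hj : b = j
    · subst hj
      by_cases hk : c = k
      · subst hk
        simp
      · simp [hk]
    · simp [hj]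
  rw [Finset.sum_congr rfl hterm, Finset.sum_ite_eq]
  by_cases hbc : (b, c) ∈ T ×ˢ T'
  · rw [if_pos hbc]
  · rw [if_neg hbc]
    by_contra hne
    exact hbc (Finset.mem_product.2 (h a b c hne))

/-- **Saturation engine 1, slot-pair form.** If for a pair of slots `s, s'` carrying a support→rank bound
the type `Λ` has `ℓ(λ^s)·ℓ(λ^{s'}) ≤ m` parts, then `Λ` is not an occurrence-obstruction type for `σ_m`:
a weight vector of type `Λ` vanishing on `GL_m³·⟨m⟩` vanishes identically (by locality it only sees a
block every tensor in which has rank `≤ ℓ(λ^s)·ℓ(λ^{s'}) ≤ m`). [this node] -/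
theorem hwvSpace_eq_bot_of_slotPair {Λ : Fin 3 → Fin m → ℕ} {d : ℕ} (s s' : Fin 3)
    (hrank : ∀ (T T' : Finset (Fin m)) (t : Tensor ℂ m),
      (∀ a b c, t a b c ≠ 0 → slot s (a, b, c) ∈ T ∧ slot s' (a, b, c) ∈ T') →
        tensorRank t ≤ T.card * T'.card)
    (hcard : (Finset.univ.filter fun a => Λ s a ≠ 0).card *
      (Finset.univ.filter fun a => Λ s' a ≠ 0).card ≤ m)
    (hU : hwvSpace Λ d ≤ orbitVanishing (unitTensor ℂ m)) : hwvSpace Λ d = ⊥ := by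
  classical
  obtain ⟨T, hT⟩ : ∃ T : Finset (Fin m), T = Finset.univ.filter fun a => Λ s a ≠ 0 := ⟨_, rfl⟩
  obtain ⟨T', hT'⟩ : ∃ T' : Finset (Fin m), T' = Finset.univ.filter fun a => Λ s' a ≠ 0 := ⟨_, rfl⟩
  have hTc : ∀ a, a ∉ T → Λ s a = 0 := fun a ha => by
    by_contra h
    exact ha (hT ▸ Finset.mem_filter.2 ⟨Finset.mem_univ a, h⟩)
  have hT'c : ∀ a, a ∉ T' → Λ s' a = 0 := fun a ha => by
    by_contra h
    exact ha (hT' ▸ Finset.mem_filter.2 ⟨Finset.mem_univ a, h⟩)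
  refine (Submodule.eq_bot_iff _).2 fun f hf => ?_
  have hfU : f ∈ orbitVanishing (unitTensor ℂ m) := hU hf
  apply MvPolynomial.funext
  intro x
  rw [map_zero, eval_eq_evalT, evalT_eq_evalT_proj hf s hTc, evalT_eq_evalT_proj hf s' hT'c]
  apply evalT_eq_zero_of_tensorRank_le hfU
  refine le_trans (hrank T T' _ fun a b c habc => ⟨?_, ?_⟩) ?_
  · by_contra hs
    exact habc (by simp [proj, hs])
  · by_contra hs'
    exact habc (by simp [proj, hs'])
  · rw [hT, hT']
    exact hcard

/-- **Saturation engine 1 (few parts in two slots).** If `ℓ(λ⁽⁰⁾)·ℓ(λ⁽¹⁾) ≤ m` then the type `Λ` is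
not an occurrence-obstruction type for `σ_m = closure(GL_m³·⟨m⟩)`: a weight vector of type `Λ` vanishing
on `GL_m³·⟨m⟩` vanishes identically (by locality it only sees an `ℓ(λ⁽⁰⁾) × ℓ(λ⁽¹⁾) × m` block, every
tensor in which has rank `≤ ℓ(λ⁽⁰⁾)·ℓ(λ⁽¹⁾) ≤ m`). [this node] -/
theorem hwvSpace_eq_bot_of_card_mul_card_le {Λ : Fin 3 → Fin m → ℕ} {d : ℕ}
    (hcard : (Finset.univ.filter fun a => Λ 0 a ≠ 0).card *
      (Finset.univ.filter fun a => Λ 1 a ≠ 0).card ≤ m)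
    (hU : hwvSpace Λ d ≤ orbitVanishing (unitTensor ℂ m)) : hwvSpace Λ d = ⊥ :=
  hwvSpace_eq_bot_of_slotPair 0 1
    (fun T T' t h => tensorRank_le_card_mul_card_of_support₀₁ T T' t fun a b c habc => by
      simpa using h a b c habc) hcard hU

/-- Engine 1 for the slot pair `0,2`. [this node] -/
theorem hwvSpace_eq_bot_of_card_mul_card_le₀₂ {Λ : Fin 3 → Fin m → ℕ} {d : ℕ}
    (hcard : (Finset.univ.filter fun a => Λ 0 a ≠ 0).card *
      (Finset.univ.filter fun a => Λ 2 a ≠ 0).card ≤ m)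
    (hU : hwvSpace Λ d ≤ orbitVanishing (unitTensor ℂ m)) : hwvSpace Λ d = ⊥ :=
  hwvSpace_eq_bot_of_slotPair 0 2
    (fun T T' t h => tensorRank_le_card_mul_card_of_support₀₂ T T' t fun a b c habc => by
      simpa using h a b c habc) hcard hU

/-- Engine 1 for the slot pair `1,2`. [this node] -/
theorem hwvSpace_eq_bot_of_card_mul_card_le₁₂ {Λ : Fin 3 → Fin m → ℕ} {d : ℕ}
    (hcard : (Finset.univ.filter fun a => Λ 1 a ≠ 0).card *
      (Finset.univ.filter fun a => Λ 2 a ≠ 0).card ≤ m)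
    (hU : hwvSpace Λ d ≤ orbitVanishing (unitTensor ℂ m)) : hwvSpace Λ d = ⊥ :=
  hwvSpace_eq_bot_of_slotPair 1 2
    (fun T T' t h => tensorRank_le_card_mul_card_of_support₁₂ T T' t fun a b c habc => by
      simpa using h a b c habc) hcard hU

/-- **Saturation engine 2 (prolongation).** In degree `d ≤ m` no type at all is an occurrence-obstruction
type for `σ_m`: a homogeneous polynomial of degree `d ≤ m` vanishing on `GL_m³·⟨m⟩` is zero (each of its
monomials involves `≤ d ≤ m` coordinates, and every tensor supported on `≤ m` coordinates has rank `≤ m`).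
[this node] -/
theorem hwvSpace_eq_bot_of_degree_le {Λ : Fin 3 → Fin m → ℕ} {d : ℕ} (hd : d ≤ m)
    (hU : hwvSpace Λ d ≤ orbitVanishing (unitTensor ℂ m)) : hwvSpace Λ d = ⊥ := by
  classical
  refine (Submodule.eq_bot_iff _).2 fun f hf => ?_
  have hfU : f ∈ orbitVanishing (unitTensor ℂ m) := hU hf
  have hhom : f.IsHomogeneous d := hf.1
  ext μ
  rw [MvPolynomial.coeff_zero]
  by_contra hμ
  -- the monomial `μ` involves at most `d ≤ m` coordinates
  have hcardμ : μ.support.card ≤ m := by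
    have hdeg : Finsupp.weight (1 : Idx m → ℕ) μ = d := hhom hμ
    have hle : μ.support.card ≤ Finsupp.weight (1 : Idx m → ℕ) μ := by
      rw [Finsupp.weight_apply, Finsupp.sum, Finset.card_eq_sum_ones]
      exact Finset.sum_le_sum fun i hi => by
        rw [Pi.one_apply, smul_eq_mul, mul_one]
        exact Nat.one_le_iff_ne_zero.2 (Finsupp.mem_support_iff.1 hi)
    rw [hdeg] at hle
    exact hle.trans hd
  -- the restriction `g` of `f` to the coordinate subspace `ℂ^P`, `P = supp μ`
  obtain ⟨P, hP⟩ : ∃ P : Finset (Idx m), P = μ.support := ⟨_, rfl⟩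
  obtain ⟨φ, hφ⟩ : ∃ φ : Idx m → MvPolynomial (Idx m) ℂ,
      φ = fun p => if p ∈ P then MvPolynomial.X p else 0 := ⟨_, rfl⟩
  -- `g` vanishes identically: its values are values of `f` at tensors of rank `≤ |P| ≤ m`
  have hg0 : MvPolynomial.aeval φ f = 0 := by
    apply MvPolynomial.funext
    intro v
    rw [map_zero, ← MvPolynomial.aeval_eq_eval, MvPolynomial.comp_aeval_apply]
    have hfun : (fun p => MvPolynomial.aeval v (φ p)) = fun p : Idx m =>
        (fun a b c => if (a, b, c) ∈ P then v (a, b, c) else 0) p.1 p.2.1 p.2.2 := by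
      funext p
      obtain ⟨a, b, c⟩ := p
      rw [hφ]
      dsimp only
      split_ifs <;> simp
    rw [hfun]
    change evalT (fun a b c => if (a, b, c) ∈ P then v (a, b, c) else 0) f = 0
    apply evalT_eq_zero_of_tensorRank_le hfU
    refine le_trans ?_ (hP ▸ hcardμ)
    refine tensorRank_le_card_of_eq_finset_sum P (fun p => Pi.single p.1 (v p))
      (fun p => Pi.single p.2.1 1) (fun p => Pi.single p.2.2 1) ?_
    funext a b c
    rw [Finset.sum_apply, Finset.sum_apply, Finset.sum_apply]
    have hterm : ∀ q ∈ P, triad (Pi.single q.1 (v q)) (Pi.single q.2.1 (1 : ℂ))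
        (Pi.single q.2.2 (1 : ℂ)) a b c = if (a, b, c) = q then v (a, b, c) else 0 := by
      rintro ⟨i, j, k⟩ _
      rw [triad_apply, Pi.single_apply, Pi.single_apply, Pi.single_apply]
      by_cases hi : a = i
      · subst hi
        by_cases hj : b = j
        · subst hj
          by_cases hk : c = k
          · subst hk
            simp
          · simp [hk]
        · simp [hj]
      · simp [hi]
    rw [Finset.sum_congr rfl hterm, Finset.sum_ite_eq]
  -- but the `μ`-coefficient of `g` is that of `f`
  have hsum : MvPolynomial.aeval φ f =
      ∑ ν ∈ f.support, MvPolynomial.aeval φ (MvPolynomial.monomial ν (MvPolynomial.coeff ν f)) := by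
    conv_lhs => rw [f.as_sum]
    rw [map_sum]
  have hterm : ∀ ν ∈ f.support,
      MvPolynomial.coeff μ (MvPolynomial.aeval φ (MvPolynomial.monomial ν (MvPolynomial.coeff ν f))) =
        if μ = ν then MvPolynomial.coeff μ f else 0 := by
    intro ν hν
    rw [MvPolynomial.aeval_monomial, MvPolynomial.algebraMap_eq]
    by_cases hsub : ν.support ⊆ P
    · have hprod : (ν.prod fun i k => φ i ^ k) = MvPolynomial.monomial ν (1 : ℂ) := by
        rw [MvPolynomial.monomial_eq, MvPolynomial.C_1, one_mul, Finsupp.prod, Finsupp.prod]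
        exact Finset.prod_congr rfl fun i hi => by
          rw [hφ]
          dsimp only
          rw [if_pos (hsub hi)]
      rw [hprod, MvPolynomial.C_mul_monomial, mul_one, MvPolynomial.coeff_monomial]
      by_cases hμν : ν = μ
      · subst hμν
        simp
      · rw [if_neg hμν, if_neg (Ne.symm hμν)]
    · obtain ⟨i, hiν, hiP⟩ := Finset.not_subset.1 hsub
      have hzero : (ν.prod fun i k => φ i ^ k) = 0 := by
        rw [Finsupp.prod]
        apply Finset.prod_eq_zero hiν
        rw [hφ]
        dsimp only
        rw [if_neg hiP, zero_pow (Finsupp.mem_support_iff.1 hiν)]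
      rw [hzero, mul_zero, MvPolynomial.coeff_zero, if_neg]
      rintro rfl
      exact hiP (hP ▸ hiν)
  have hcoeff : MvPolynomial.coeff μ (MvPolynomial.aeval φ f) = MvPolynomial.coeff μ f := by
    rw [hsum, MvPolynomial.coeff_sum, Finset.sum_congr rfl hterm, Finset.sum_ite_eq,
      if_pos (MvPolynomial.mem_support_iff.2 hμ)]
  rw [hg0, MvPolynomial.coeff_zero] at hcoeff
  exact hμ hcoeff.symm

end Locality

end Summit.MatrixMultiplication.MatrixMultiplication.Theorems.ObstructionCalculus

end
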